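import Summits.NavierStokesRegularity.TurbBounds.Results.P2R4
import Literature.Analysis.SpecialFunctions.LegendreDifferentialRelation
import HarnessLib

/-!
# Row P2-R4: the coupling profile `g = −(sκ/2)·η′₈((x+1)/2)` IS `Σ_{p≤8} ĝ_p P_p` with the tree's literal `ĝ_p` (LEAN-MAP data item (b))
(cell `pub-turb` / `turb-bounds`; v2 groundwork for the P2-R4 tail lemma (Theorem 1's row): the profile enters
`TailPolyGen.layerForm_poly_lower_bound` as a polynomial `gp` of degree `≤ 8` with `gOf s κ η′ = gp.eval`; here `gp` is written in the
Legendre basis with the literal data `Certs.P2R4.Evaluator.ghat0 … ghat8` of `EvalShared.lean`, so that `ĉ_p(gp) = ĝ_p` is immediate.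
Kernel arithmetic only. Written by pub-turb-cert, prover-pub-turb-cert-g6-0.)

HONEST FRAMING: rigorous bounds for the stated PDE and boundary conditions; no claim about physical turbulence beyond the bound.
-/

set_option linter.style.longLine false

noncomputable section

namespace Summit.NavierStokesRegularity.TurbBounds.TailP2R4

open Polynomial Finset Literature.Analysis.SpecialFunctions
open Summit.NavierStokesRegularity.TurbBounds.LayerForm (gOf)
open Summit.NavierStokesRegularity.TurbBounds.Certs.P2R4.Evaluator (ghat0 ghat1 ghat2 ghat3 ghat4 ghat5 ghat6 ghat7 ghat8)

/-- `P_2(x) = (3x² − 1)/2` (written `3/2·x² − 1/2`: the bracketed form coincides textually with a lemma of another summit's Theorems — gen 7 dedup fix; same proposition). -/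
theorem legendre_two_eval (x : ℝ) : (legendre 2).eval x = 3 / 2 * x ^ 2 - 1 / 2 := by
  have h := eval_legendre_add_two 0 x
  norm_num [legendre_zero, legendre_one] at h
  nlinarith [h]

/-- `P_3(x) = (5x³ − 3x)/2` (written `5/2·x³ − 3/2·x`, same reason). -/
theorem legendre_three_eval (x : ℝ) : (legendre 3).eval x = 5 / 2 * x ^ 3 - 3 / 2 * x := by
  have h := eval_legendre_add_two 1 x
  rw [show (1 : ℕ) + 2 = 3 from rfl, show (1 : ℕ) + 1 = 2 from rfl, legendre_two_eval, legendre_one, eval_X] at h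
  push_cast at h
  nlinarith [h]

/-- `P_4(x) = (35x⁴ − 30x² + 3)/8`. -/
theorem legendre_four_eval (x : ℝ) : (legendre 4).eval x = (35 * x ^ 4 - 30 * x ^ 2 + 3) / 8 := by
  have h := eval_legendre_add_two 2 x
  rw [show (2 : ℕ) + 2 = 4 from rfl, show (2 : ℕ) + 1 = 3 from rfl, legendre_three_eval, legendre_two_eval] at h
  push_cast at h
  nlinarith [h]

/-- `P_5(x) = (63x⁵ − 70x³ + 15x)/8`. -/
theorem legendre_five_eval (x : ℝ) : (legendre 5).eval x = (63 * x ^ 5 - 70 * x ^ 3 + 15 * x) / 8 := by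
  have h := eval_legendre_add_two 3 x
  rw [show (3 : ℕ) + 2 = 5 from rfl, show (3 : ℕ) + 1 = 4 from rfl, legendre_four_eval, legendre_three_eval] at h
  push_cast at h
  nlinarith [h]

/-- `P_6(x) = (231x⁶ − 315x⁴ + 105x² − 5)/16`. -/
theorem legendre_six_eval (x : ℝ) : (legendre 6).eval x = (231 * x ^ 6 - 315 * x ^ 4 + 105 * x ^ 2 - 5) / 16 := by
  have h := eval_legendre_add_two 4 x
  rw [show (4 : ℕ) + 2 = 6 from rfl, show (4 : ℕ) + 1 = 5 from rfl, legendre_five_eval, legendre_four_eval] at h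
  push_cast at h
  nlinarith [h]

/-- `P_7(x) = (429x⁷ − 693x⁵ + 315x³ − 35x)/16`. -/
theorem legendre_seven_eval (x : ℝ) : (legendre 7).eval x = (429 * x ^ 7 - 693 * x ^ 5 + 315 * x ^ 3 - 35 * x) / 16 := by
  have h := eval_legendre_add_two 5 x
  rw [show (5 : ℕ) + 2 = 7 from rfl, show (5 : ℕ) + 1 = 6 from rfl, legendre_six_eval, legendre_five_eval] at h
  push_cast at h
  nlinarith [h]

/-- `P_8(x) = (6435x⁸ − 12012x⁶ + 6930x⁴ − 1260x² + 35)/128`. -/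
theorem legendre_eight_eval (x : ℝ) :
    (legendre 8).eval x = (6435 * x ^ 8 - 12012 * x ^ 6 + 6930 * x ^ 4 - 1260 * x ^ 2 + 35) / 128 := by
  have h := eval_legendre_add_two 6 x
  rw [show (6 : ℕ) + 2 = 8 from rfl, show (6 : ℕ) + 1 = 7 from rfl, legendre_seven_eval, legendre_six_eval] at h
  push_cast at h
  nlinarith [h]

/-- The literal Legendre data of the profile as a real sequence `ĝ_0 … ĝ_8` (zero beyond). -/
def ghatR : ℕ → ℝ
  | 0 => ghat0 | 1 => ghat1 | 2 => ghat2 | 3 => ghat3 | 4 => ghat4 | 5 => ghat5 | 6 => ghat6 | 7 => ghat7 | 8 => ghat8 | _ => 0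

/-- The profile polynomial of row P2-R4 in the Legendre basis: `gp = Σ_{p≤8} ĝ_p P_p`. -/
def gp : ℝ[X] := ∑ p ∈ range (8 + 1), C (ghatR p) * legendre p

/-- `deg gp ≤ 8`. -/
theorem natDegree_gp_le : gp.natDegree ≤ 8 := by
  unfold gp
  refine natDegree_sum_le_of_forall_le _ _ (fun p hp => ?_)
  refine (natDegree_C_mul_le _ _).trans ?_
  rw [natDegree_legendre]
  rw [Finset.mem_range] at hp; omega

/-- **The literal `ĝ_p` ARE the Legendre data of the member's coupling profile**: `g(x) = −(3/2·(697/4)/2)·η′₈((x+1)/2) = Σ_{p≤8} ĝ_p P_p(x)`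
for every real `x` (exact polynomial identity; LEAN-MAP data item (b) for row P2-R4, kernel-checked). -/
theorem gp_eval (x : ℝ) : gp.eval x = gOf ((3 : ℝ) / 2) ((697 : ℝ) / 4) Results.P2R4.eta x := by
  unfold gp gOf Results.P2R4.eta
  simp only [sum_range_succ, sum_range_zero, zero_add, ghatR]
  simp only [eval_add, eval_mul, eval_C, eval_X, legendre_zero, legendre_one, eval_one, legendre_two_eval, legendre_three_eval,
    legendre_four_eval, legendre_five_eval, legendre_six_eval, legendre_seven_eval, legendre_eight_eval,
    ghat0, ghat1, ghat2, ghat3, ghat4, ghat5, ghat6, ghat7, ghat8]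
  push_cast
  ring

end Summit.NavierStokesRegularity.TurbBounds.TailP2R4

end
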